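import Summits.AtomisticToContinuum.FouriersLaw.Theses.EmbeddedDrudeMourre
import Summits.AtomisticToContinuum.FouriersLaw.Theses.KineticCorner
import Summits.AtomisticToContinuum.FouriersLaw.Theorems.EmbeddedDrudeMourreMourreDissolutionOfKineticCorner
import Summits.AtomisticToContinuum.FouriersLaw.Theorems.EmbeddedDrudeMourreDrudeDissolutionStubTargetGlue
import Summits.AtomisticToContinuum.FouriersLaw.Theorems.KineticCornerStationaryCorrelationBound
import Summits.AtomisticToContinuum.FouriersLaw.Theorems.KineticCornerGoodFamilyExists
import HarnessLib

/-!
# `DrudeDissolution` (stmt-AtomisticToContinuum-12593) from route KineticCorner's two cruxes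
# `PostKineticTail` (stmt-3430) and `KineticLimit` (stmt-3431) — the deliverable of line `Sketch`, rev 10

`--supports stmt-AtomisticToContinuum-12593` (lead `prover-line-stmt-AtomisticToContinuum-12593-c5-0`). With every provable
support item of route `KineticCorner` now CLOSED — `GoodFamilyExists` (stmt-3434, `goodFamilyExists_proof`), `TargetGlue`
(stmt-3436, `LineSketch.stub_targetGlue`), `StationaryCorrelationBound` (stmt-3435, `stationaryCorrelationBound_proof`) — the
kinetic-corner Green–Kubo law `KineticCornerGreenKubo` (stmt-3429), hence (by the landed bridge
`drudeDissolution_of_kineticCornerGreenKubo`, p121356) the dissolved Drude atom `DrudeDissolution` and the sibling crux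
`MourreDissolution` (stmt-12594), follow from EXACTLY the route's two cruxes:
* `PostKineticTail` — decay of the summed current autocorrelation `C_T` beyond all kinetic times at fixed small `T`;
* `KineticLimit` — the wave-kinetic limit of `C_T` on kinetic windows with a positive kinetic conductivity `∫₀^∞ K > 0`.
Both are research-open (BLR2000 §7; Lukkarinen–Spohn programme); this file is the sorry-free composition of the line's skeleton
(`Cruxes/DrudeDissolution/Lines/Sketch.lean`, rev 10) with the two open stubs as explicit hypotheses. CONDITIONAL results.
-/

namespace Summit.AtomisticToContinuum.FouriersLaw.Theorems.DrudeDissolution.LineSketch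

/-- **`KineticCornerGreenKubo ⇐ PostKineticTail ∧ KineticLimit`** (route KineticCorner's target, stmt-3429, from its two cruxes
stmt-3430, stmt-3431): the landed glue `TargetGlue` with its other two hypotheses discharged by the landed
`stationaryCorrelationBound_proof` and `goodFamilyExists_proof`. CONDITIONAL (both hypotheses open). [folklore] -/
theorem kineticCornerGreenKubo_of_postKineticTail_of_kineticLimit :
    Summit.AtomisticToContinuum.FouriersLaw.Theses.KineticCorner.PostKineticTail →
      Summit.AtomisticToContinuum.FouriersLaw.Theses.KineticCorner.KineticLimit →
        Summit.AtomisticToContinuum.FouriersLaw.Theses.KineticCorner.KineticCornerGreenKubo :=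
  fun hPKT hKL => stub_targetGlue hPKT hKL KineticCorner.stationaryCorrelationBound_proof KineticCorner.goodFamilyExists_proof

/-- **`DrudeDissolution ⇐ PostKineticTail ∧ KineticLimit`** (the crux stmt-AtomisticToContinuum-12593 from route KineticCorner's
two cruxes stmt-3430, stmt-3431): `kineticCornerGreenKubo_of_postKineticTail_of_kineticLimit` followed by the bridge
`drudeDissolution_of_kineticCornerGreenKubo`. CONDITIONAL (both hypotheses open); the deliverable of line `Sketch`. [folklore] -/
theorem drudeDissolution_of_postKineticTail_of_kineticLimit :
    Summit.AtomisticToContinuum.FouriersLaw.Theses.KineticCorner.PostKineticTail →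
      Summit.AtomisticToContinuum.FouriersLaw.Theses.KineticCorner.KineticLimit →
        Summit.AtomisticToContinuum.FouriersLaw.Theses.EmbeddedDrudeMourre.DrudeDissolution :=
  fun hPKT hKL => MourreDissolution.drudeDissolution_of_kineticCornerGreenKubo
    (kineticCornerGreenKubo_of_postKineticTail_of_kineticLimit hPKT hKL)

end Summit.AtomisticToContinuum.FouriersLaw.Theorems.DrudeDissolution.LineSketch
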